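import Mathlib
import Summits.CriticalPhenomena.CardyFormulaZ2.Theorems.CardySelfRefinementGradientComparabilityStubNonAxialShareBulkLocal
import Literature.Probability.Percolation.InsertionTolerance
import Literature.Probability.Percolation.DeletionTolerance
import HarnessLib

/-!
# (D4-bulk) Bulk transfer of pivotality from axial to non-axial edges

Crux `stmt-CriticalPhenomena-10269`
(`Summit.CriticalPhenomena.CardyFormulaZ2.Theses.CardySelfRefinement.GradientComparability`),
line **Sketch**, stub `stub_nonAxialShare_bulk`: for `k ∈ {2, 3}`, a finite quad family `F` and
`r > 0` there are `c₁ > 0`, `η₄ > 0` such that for every mesh `η ∈ (0, η₄)` the sum over the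
`r`-bulk window edges `Wb` of `P_{1/2}(e pivotal for Aloc m F η)` is at most `c₁⁻¹` times the
same sum over a finite set `W'` of NON-AXIAL edges (`edgeOf (v, d)` with `¬ ax k (v, d)`).
Together with the bulk divergence `stub_bulkPivotalSum_diverges` this gives the divergence of the
non-axial pivotal sum, clause (ii) of the crux at the endpoint `(0, ½)`.

## Proof

* `real_setOf_exists_modification_le` — finite energy: for a finite set `N` of lattice edges the
  probability that SOME modification of `ω` on `N` lands in a measurable `E` is
  `≤ 8^{|N|} P(E)` (insertion / deletion tolerance over the `2^{|N|}` target patterns);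
* `real_isPivotal_le_sum_targets` — for `e = edgeOf (v, d)` with `r`-far ends (`r ≥ 20η`),
  `P(e pivotal) ≤ 8^{162} Σ P(edgeOf (v + Δ, d + ρ) pivotal)` over the non-axial targets with
  `|Δ|_∞ ≤ 4` (for axial `e`: the deterministic `local_modification` of `…BulkLocal.lean` moves
  `{e pivotal}` into the union of the modification events of its non-axial targets, all
  modifications living on the `≤ 162` genuine edges within four steps of `v`; for non-axial `e`
  the target `e` itself);
* the stub: re-index `Wb` by `edgeOf`, exchange the two sums, and use that for each offset
  `(Δ, ρ)` the map `(v, d) ↦ (v + Δ, d + ρ)` is injective, so that each offset contributes at most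
  `Σ_{W'}`; `c₁ = 8^{-162}/162`, `η₄ = r/20`.
-/

noncomputable section

namespace Summit.CriticalPhenomena.CardyFormulaZ2.Theorems.CardySelfRefinement

open scoped Topology
open Filter Set MeasureTheory Metric
open Literature.Probability.LatticeModels Literature.Probability.Percolation
open Literature.Probability.Percolation.QuadCrossing
open Summit.CriticalPhenomena.CardyFormulaZ2.Theses.CardySelfRefinement

variable {D : Set ℂ} {δ : ℝ}


/-! ## Finite energy: the cost of a local modification -/

/-- **Local modification costs a bounded factor.**  For a finite set `N` of lattice edges and a
measurable event `E`, the `P_{1/2}`-probability that SOME modification of `ω` on `N` lies in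
`E` is at most `8^{|N|} P_{1/2}(E)` (union over the `2^{|N|}` target patterns of insertion and
deletion tolerance, `bondPercolation_pow_mul_real_preimage_openEdges_le` /
`…closeEdges_le`). -/
theorem real_setOf_exists_modification_le (N : Finset (Sym2 (Site 2)))
    (hN : (↑N : Set (Sym2 (Site 2))) ⊆ (zdGraph 2).edgeSet) {E : Set (BondConfig (Site 2))}
    (hE : MeasurableSet E) :
    (bondPercolation (zdGraph 2) half).real
        {ω | ∃ Rm S : Set (Sym2 (Site 2)), Rm ∪ S ⊆ ↑N ∧ ω \ Rm ∪ S ∈ E} ≤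
      8 ^ N.card * (bondPercolation (zdGraph 2) half).real E := by
  classical
  set μ := bondPercolation (zdGraph 2) half with hμ
  have hhalf : ((half : unitInterval) : ℝ) = 1 / 2 := rfl
  -- cover by the target patterns on `N`
  have hcov : {ω : BondConfig (Site 2) | ∃ Rm S : Set (Sym2 (Site 2)), Rm ∪ S ⊆ ↑N ∧ ω \ Rm ∪ S ∈ E} ⊆
      ⋃ T ∈ N.powerset, closeEdges (↑N : Set _) ⁻¹' (openEdges (↑T : Set _) ⁻¹' E) := by
    rintro ω ⟨Rm, S, hRS, hωE⟩
    set T : Finset (Sym2 (Site 2)) := N.filter (fun x => x ∈ ω \ Rm ∪ S) with hT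
    refine Set.mem_iUnion₂.2 ⟨T, Finset.mem_powerset.2 (Finset.filter_subset _ _), ?_⟩
    show closeEdges (↑N : Set _) ω ∪ ↑T ∈ E
    convert hωE using 1
    ext x
    simp only [closeEdges, Set.mem_union, Set.mem_sdiff, hT, Finset.coe_filter, Set.mem_setOf_eq,
      Finset.mem_coe]
    constructor
    · rintro (⟨hxω, hxN⟩ | ⟨-, h⟩)
      · exact Or.inl ⟨hxω, fun h => hxN (hRS (Or.inl h))⟩
      · exact h
    · intro h
      by_cases hxN : x ∈ N
      · exact Or.inr ⟨hxN, h⟩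
      · rcases h with h | h
        · exact Or.inl ⟨h.1, hxN⟩
        · exact absurd (hRS (Or.inr h)) hxN
  -- each pattern costs `4^{|N|}`
  have hT : ∀ T ∈ N.powerset,
      μ.real (closeEdges (↑N : Set _) ⁻¹' (openEdges (↑T : Set _) ⁻¹' E)) ≤ 4 ^ N.card * μ.real E := by
    intro T hT
    have hTN : T ⊆ N := Finset.mem_powerset.1 hT
    have hE' : MeasurableSet (openEdges (↑T : Set _) ⁻¹' E) := measurable_openEdges _ hE
    have h1 := bondPercolation_pow_mul_real_preimage_closeEdges_le (zdGraph 2) half N hE'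
    have h2 := bondPercolation_pow_mul_real_preimage_openEdges_le (zdGraph 2) half T
      ((Finset.coe_subset.2 hTN).trans hN) hE
    rw [hhalf, ← hμ] at h1 h2
    norm_num at h1 h2
    have hcard : T.card ≤ N.card := Finset.card_le_card hTN
    have hpow : ((1 : ℝ) / 2) ^ N.card ≤ (1 / 2) ^ T.card :=
      pow_le_pow_of_le_one (by norm_num) (by norm_num) hcard
    have h4 : (4 : ℝ) ^ N.card * ((1 / 2) ^ N.card * (1 / 2) ^ N.card) = 1 := by
      rw [← mul_pow, ← mul_pow]; norm_num
    have hy : 0 ≤ μ.real (openEdges (↑T : Set _) ⁻¹' E) := measureReal_nonneg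
    calc μ.real (closeEdges (↑N : Set _) ⁻¹' (openEdges (↑T : Set _) ⁻¹' E))
        = (4 : ℝ) ^ N.card * (1 / 2) ^ N.card * ((1 / 2) ^ N.card *
            μ.real (closeEdges (↑N : Set _) ⁻¹' (openEdges (↑T : Set _) ⁻¹' E))) := by
          rw [← mul_assoc, show (4 : ℝ) ^ N.card * (1 / 2) ^ N.card * (1 / 2) ^ N.card =
            4 ^ N.card * ((1 / 2) ^ N.card * (1 / 2) ^ N.card) by ring, h4, one_mul]
      _ ≤ (4 : ℝ) ^ N.card * (1 / 2) ^ N.card * μ.real (openEdges (↑T : Set _) ⁻¹' E) :=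
          mul_le_mul_of_nonneg_left h1 (by positivity)
      _ = (4 : ℝ) ^ N.card * ((1 / 2) ^ N.card * μ.real (openEdges (↑T : Set _) ⁻¹' E)) := by ring
      _ ≤ (4 : ℝ) ^ N.card * ((1 / 2) ^ T.card * μ.real (openEdges (↑T : Set _) ⁻¹' E)) :=
          mul_le_mul_of_nonneg_left (mul_le_mul_of_nonneg_right hpow hy) (by positivity)
      _ ≤ 4 ^ N.card * μ.real E := mul_le_mul_of_nonneg_left h2 (by positivity)
  calc μ.real {ω | ∃ Rm S : Set (Sym2 (Site 2)), Rm ∪ S ⊆ ↑N ∧ ω \ Rm ∪ S ∈ E}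
      ≤ μ.real (⋃ T ∈ N.powerset, closeEdges (↑N : Set _) ⁻¹' (openEdges (↑T : Set _) ⁻¹' E)) :=
        measureReal_mono hcov (measure_ne_top _ _)
    _ ≤ ∑ T ∈ N.powerset, μ.real (closeEdges (↑N : Set _) ⁻¹' (openEdges (↑T : Set _) ⁻¹' E)) :=
        measureReal_biUnion_finset_le (μ := μ) _ _
    _ ≤ ∑ _T ∈ N.powerset, 4 ^ N.card * μ.real E := Finset.sum_le_sum hT
    _ = 8 ^ N.card * μ.real E := by
        rw [Finset.sum_const, Finset.card_powerset, nsmul_eq_mul]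
        rw [show (8 : ℝ) ^ N.card = 2 ^ N.card * 4 ^ N.card by rw [← mul_pow]; norm_num]
        push_cast; ring

/-! ## Lattice edges as `edgeOf` -/

/-- Every lattice edge of `ℤ²` is `edgeOf (v, d)` for some base `v` and direction `d`. -/
theorem exists_eq_edgeOf_of_adj {x y : Site 2} (h : (zdGraph 2).Adj x y) :
    ∃ d : Fin 2, s(x, y) = edgeOf (x, d) ∨ s(x, y) = edgeOf (y, d) := by
  obtain ⟨i, hi | hi⟩ := (zdGraph_adj_iff x y).1 h
  · refine ⟨i, Or.inl ?_⟩
    show s(x, y) = s(x, x + dirVec i)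
    rw [show (dirVec i : Site 2) = Pi.single i 1 from dirVec_eq_single i, ← hi]
  · refine ⟨i, Or.inr ?_⟩
    show s(x, y) = s(y, y + dirVec i)
    rw [show (dirVec i : Site 2) = Pi.single i 1 from dirVec_eq_single i, ← hi, Sym2.eq_swap]

/-- `edgeOf vd` is a lattice edge. -/
theorem edgeOf_mem_edgeSet' (vd : Site 2 × Fin 2) : edgeOf vd ∈ (zdGraph 2).edgeSet := by
  rw [SimpleGraph.mem_edgeSet]
  have := frame_adj (V := fun a b => vd.1 + a • dirVec vd.2 + b • dirVec (1 - vd.2)) (fun _ _ => rfl)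
    (frame_std vd.2) (a := 0) (b := 0) (a' := 1) (b' := 0) (by norm_num)
  simpa using this

/-- A genuine edge within four steps of `v` is a shifted `edgeOf`. -/
theorem exists_target_of_near {v : Site 2} {x : Sym2 (Site 2)}
    (hx : ∃ a b, x = s(a, b) ∧ (zdGraph 2).Adj a b ∧ ∀ i, |a i - v i| ≤ 4 ∧ |b i - v i| ≤ 4) :
    ∃ ι : (ℤ × ℤ) × Fin 2, (|ι.1.1| ≤ 4 ∧ |ι.1.2| ≤ 4) ∧ edgeOf (v + ![ι.1.1, ι.1.2], ι.2) = x := by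
  obtain ⟨a, b, hxab, hab, hnear⟩ := hx
  rw [hxab]
  obtain ⟨d, h | h⟩ := exists_eq_edgeOf_of_adj hab
  · refine ⟨((a 0 - v 0, a 1 - v 1), d), ⟨(hnear 0).1, (hnear 1).1⟩, ?_⟩
    show edgeOf (v + ![a 0 - v 0, a 1 - v 1], d) = s(a, b)
    rw [show v + ![a 0 - v 0, a 1 - v 1] = a by ext i; fin_cases i <;> simp]; exact h.symm
  · refine ⟨((b 0 - v 0, b 1 - v 1), d), ⟨(hnear 0).2, (hnear 1).2⟩, ?_⟩
    show edgeOf (v + ![b 0 - v 0, b 1 - v 1], d) = s(a, b)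
    rw [show v + ![b 0 - v 0, b 1 - v 1] = b by ext i; fin_cases i <;> simp]; exact h.symm

/-- **Per-edge transfer.**  For an edge `edgeOf vd` whose ends are `r`-far from all sides
(`r ≥ 20η`), `P_{1/2}(edgeOf vd pivotal for Aloc) ≤ 8^{162} Σ P_{1/2}(edgeOf t pivotal)` over the
NON-AXIAL targets `t = (v + Δ, d + ρ)`, `Δ ∈ [-4, 4]²`, `ρ ∈ Fin 2` (indexed by a finite set
`I₀` of offsets; `local_modification` + `real_setOf_exists_modification_le` for axial edges, the
target `t = vd` itself otherwise). -/
theorem real_isPivotal_le_sum_targets {k : ℕ} (hk : k = 2 ∨ k = 3) {m : ℕ}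
    (F : Fin m → Quad (Set.univ : Set ℂ)) {r η : ℝ} (hη : 0 < η) (hηr : 20 * η ≤ r)
    (I₀ : Finset ((ℤ × ℤ) × Fin 2)) (hI₀ : ∀ ι, ι ∈ I₀ ↔ |ι.1.1| ≤ 4 ∧ |ι.1.2| ≤ 4)
    (hI₀card : I₀.card ≤ 162) (vd : Site 2 × Fin 2)
    (hfar : ∀ x ∈ edgeOf vd, ∀ (i : Fin m) (j : Fin 4), ∀ q ∈ (F i).side j,
      r ≤ dist ((η : ℂ) * squareLatticeEmbedding.z x) q) :
    (bondPercolation (zdGraph 2) half).real {ω | IsPivotal (Aloc m F η) (edgeOf vd) ω} ≤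
      8 ^ 162 * ∑ ι ∈ I₀.filter (fun ι => ¬ ax k (vd.1 + ![ι.1.1, ι.1.2], vd.2 + ι.2)),
        (bondPercolation (zdGraph 2) half).real
          {ω | IsPivotal (Aloc m F η) (edgeOf (vd.1 + ![ι.1.1, ι.1.2], vd.2 + ι.2)) ω} := by
  classical
  obtain ⟨v, d⟩ := vd
  set μ := bondPercolation (zdGraph 2) half with hμ
  obtain ⟨N, hN_def⟩ : ∃ N : Finset (Sym2 (Site 2)), N = I₀.image fun ι => edgeOf (v + ![ι.1.1, ι.1.2], ι.2) :=
    ⟨_, rfl⟩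
  have hN : (↑N : Set (Sym2 (Site 2))) ⊆ (zdGraph 2).edgeSet := by
    intro x hx
    rw [hN_def] at hx
    obtain ⟨ι, -, hι⟩ := Finset.mem_image.1 (Finset.mem_coe.1 hx)
    rw [← hι]; exact edgeOf_mem_edgeSet' _
  have hNcard : N.card ≤ 162 := by rw [hN_def]; exact Finset.card_image_le.trans hI₀card
  have hmeas : ∀ e, MeasurableSet {ω : BondConfig (Site 2) | IsPivotal (Aloc m F η) e ω} := fun e =>
    measurableSet_setOf_isPivotal (measurableSet_Aloc m F hη.ne') e
  have hnonneg : ∀ ι ∈ I₀.filter (fun ι => ¬ ax k (v + ![ι.1.1, ι.1.2], d + ι.2)),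
      0 ≤ μ.real {ω | IsPivotal (Aloc m F η) (edgeOf (v + ![ι.1.1, ι.1.2], d + ι.2)) ω} :=
    fun _ _ => measureReal_nonneg
  have h8 : (1 : ℝ) ≤ 8 ^ 162 := one_le_pow₀ (by norm_num)
  by_cases hax : ax k (v, d)
  · -- axial: local modification
    have hcov : {ω : BondConfig (Site 2) | IsPivotal (Aloc m F η) (edgeOf (v, d)) ω} ⊆
        ⋃ ι ∈ I₀.filter (fun ι => ¬ ax k (v + ![ι.1.1, ι.1.2], d + ι.2)),
          {ω | ∃ Rm S : Set (Sym2 (Site 2)), Rm ∪ S ⊆ ↑N ∧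
            ω \ Rm ∪ S ∈ {ω | IsPivotal (Aloc m F η) (edgeOf (v + ![ι.1.1, ι.1.2], d + ι.2)) ω}} := by
      intro ω hω
      obtain ⟨Rm, S, e', ⟨v', d', he', hnax, hv'⟩, hnear, hpiv'⟩ :=
        local_modification hk F hη hηr hax hfar hω
      have hvv' : v + ![v' 0 - v 0, v' 1 - v 1] = v' := by ext i; fin_cases i <;> simp
      have hdd' : d + (d' - d) = d' := by abel
      refine Set.mem_iUnion₂.2 ⟨((v' 0 - v 0, v' 1 - v 1), d' - d), Finset.mem_filter.2 ⟨?_, ?_⟩,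
        Rm, S, fun x hx => ?_, ?_⟩
      · exact (hI₀ _).2 ⟨hv' 0, hv' 1⟩
      · show ¬ ax k (v + ![v' 0 - v 0, v' 1 - v 1], d + (d' - d))
        rw [hvv', hdd']; exact hnax
      · obtain ⟨ι, hι, hιx⟩ := exists_target_of_near (hnear x hx)
        rw [Finset.mem_coe, hN_def, Finset.mem_image]
        exact ⟨ι, (hI₀ ι).2 hι, hιx⟩
      · show ω \ Rm ∪ S ∈ {ω | IsPivotal (Aloc m F η) (edgeOf (v + ![v' 0 - v 0, v' 1 - v 1], d + (d' - d))) ω}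
        rw [hvv', hdd', ← he']; exact hpiv'
    calc μ.real {ω | IsPivotal (Aloc m F η) (edgeOf (v, d)) ω}
        ≤ μ.real (⋃ ι ∈ I₀.filter (fun ι => ¬ ax k (v + ![ι.1.1, ι.1.2], d + ι.2)),
            {ω | ∃ Rm S : Set (Sym2 (Site 2)), Rm ∪ S ⊆ ↑N ∧
              ω \ Rm ∪ S ∈ {ω | IsPivotal (Aloc m F η) (edgeOf (v + ![ι.1.1, ι.1.2], d + ι.2)) ω}}) :=
          measureReal_mono hcov (measure_ne_top _ _)
      _ ≤ ∑ ι ∈ I₀.filter (fun ι => ¬ ax k (v + ![ι.1.1, ι.1.2], d + ι.2)),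
            μ.real {ω | ∃ Rm S : Set (Sym2 (Site 2)), Rm ∪ S ⊆ ↑N ∧
              ω \ Rm ∪ S ∈ {ω | IsPivotal (Aloc m F η) (edgeOf (v + ![ι.1.1, ι.1.2], d + ι.2)) ω}} :=
          measureReal_biUnion_finset_le (μ := μ) _ _
      _ ≤ ∑ ι ∈ I₀.filter (fun ι => ¬ ax k (v + ![ι.1.1, ι.1.2], d + ι.2)),
            8 ^ 162 * μ.real {ω | IsPivotal (Aloc m F η) (edgeOf (v + ![ι.1.1, ι.1.2], d + ι.2)) ω} := by
          refine Finset.sum_le_sum fun ι _ => (real_setOf_exists_modification_le N hN (hmeas _)).trans ?_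
          exact mul_le_mul_of_nonneg_right (pow_le_pow_right₀ (by norm_num) hNcard) measureReal_nonneg
      _ = _ := by rw [Finset.mul_sum]
  · -- non-axial: the edge itself is a target
    have hv0 : v + ![0, 0] = v := by ext i; fin_cases i <;> simp
    have hmem : (((0 : ℤ), (0 : ℤ)), (0 : Fin 2)) ∈ I₀.filter (fun ι => ¬ ax k (v + ![ι.1.1, ι.1.2], d + ι.2)) := by
      refine Finset.mem_filter.2 ⟨(hI₀ _).2 ⟨by norm_num, by norm_num⟩, ?_⟩
      show ¬ ax k (v + ![0, 0], d + 0)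
      rw [hv0, add_zero]; exact hax
    have hsingle := Finset.single_le_sum hnonneg hmem
    have heq : μ.real {ω | IsPivotal (Aloc m F η) (edgeOf (v + ![0, 0], d + 0)) ω} =
        μ.real {ω | IsPivotal (Aloc m F η) (edgeOf (v, d)) ω} := by rw [hv0, add_zero]
    calc μ.real {ω | IsPivotal (Aloc m F η) (edgeOf (v, d)) ω}
        ≤ 1 * ∑ ι ∈ I₀.filter (fun ι => ¬ ax k (v + ![ι.1.1, ι.1.2], d + ι.2)),
            μ.real {ω | IsPivotal (Aloc m F η) (edgeOf (v + ![ι.1.1, ι.1.2], d + ι.2)) ω} := by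
          rw [one_mul, ← heq]; exact hsingle
      _ ≤ _ := mul_le_mul_of_nonneg_right h8 (Finset.sum_nonneg hnonneg)

/-! ## The stub -/

/-- **(D4-bulk) Bulk transfer of pivotality to non-axial edges.**  For `k ∈ {2, 3}`, a finite
quad family `F` and `r > 0` there are `c₁ > 0` and `η₄ > 0` such that for every mesh
`η ∈ (0, η₄)` and the set `Wb` of window edges whose ends are `r`-far from all sides of all quads,
`c₁ Σ_{e ∈ Wb} P_{1/2}(e pivotal for Aloc) ≤ Σ_{e ∈ W'} P_{1/2}(e pivotal for Aloc)` for a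
finite set `W'` of NON-AXIAL edges.  Proof: each `P(e pivotal)`, `e = edgeOf (v, d) ∈ Wb`, is at
most `8^{162}` times the sum of `P(e' pivotal)` over the non-axial targets `e' = edgeOf (v + Δ,
d + ρ)`, `|Δ|_∞ ≤ 4` (`real_isPivotal_le_sum_targets`: a deterministic local modification in the
cells beside `e`, `local_modification`, and finite energy); for each offset `(Δ, ρ)` the map
`(v, d) ↦ (v + Δ, d + ρ)` is injective, so summing over `Wb` and exchanging the sums bounds
`Σ_{Wb}` by `8^{162} · 162 · Σ_{W'}` with `W'` the set of all non-axial targets; `c₁ = 8^{-162}/162`,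
`η₄ = r/20`. -/
theorem stub_nonAxialShare_bulk :
    ∀ k : ℕ, k = 2 ∨ k = 3 → ∀ (m : ℕ) (F : Fin m → Quad (Set.univ : Set ℂ)) (r : ℝ), 0 < r →
      ∃ c₁ η₄ : ℝ, 0 < c₁ ∧ 0 < η₄ ∧ ∀ η ∈ Set.Ioo 0 η₄,
        ∀ Wb : Finset (Sym2 (Site 2)),
          (↑Wb : Set (Sym2 (Site 2))) = {e ∈ window m F η | ∀ x ∈ e, ∀ (i : Fin m) (j : Fin 4),
              ∀ p ∈ (F i).side j, r ≤ dist ((η : ℂ) * squareLatticeEmbedding.z x) p} →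
          ∃ W' : Finset (Sym2 (Site 2)),
            (∀ e ∈ W', ∃ (v : Site 2) (d : Fin 2), e = edgeOf (v, d) ∧ ¬ ax k (v, d)) ∧
            c₁ * (∑ e ∈ Wb, (bondPercolation (zdGraph 2) half).real {ω | IsPivotal (Aloc m F η) e ω}) ≤
              ∑ e ∈ W', (bondPercolation (zdGraph 2) half).real {ω | IsPivotal (Aloc m F η) e ω} := by
  intro k hk m F r hr
  classical
  -- the offsets `(Δ, ρ)`, `|Δ|_∞ ≤ 4`
  obtain ⟨I₀, hI₀, hI₀card⟩ : ∃ I₀ : Finset ((ℤ × ℤ) × Fin 2),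
      (∀ ι, ι ∈ I₀ ↔ |ι.1.1| ≤ 4 ∧ |ι.1.2| ≤ 4) ∧ I₀.card = 162 := by
    refine ⟨(Finset.Icc (-4 : ℤ) 4 ×ˢ Finset.Icc (-4 : ℤ) 4) ×ˢ (Finset.univ : Finset (Fin 2)),
      fun ι => ?_, by simp⟩
    simp only [Finset.mem_product, Finset.mem_Icc, Finset.mem_univ, and_true, abs_le]
  refine ⟨1 / (8 ^ 162 * 162), r / 20, by positivity, by positivity, fun η hη Wb hWb => ?_⟩
  have hη0 : 0 < η := hη.1
  have hηr : 20 * η ≤ r := by linarith [hη.2]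
  set μ := bondPercolation (zdGraph 2) half with hμ
  set P : Sym2 (Site 2) → ℝ := fun e => μ.real {ω | IsPivotal (Aloc m F η) e ω} with hP
  have hP0 : ∀ e, 0 ≤ P e := fun e => measureReal_nonneg
  set tgt : Site 2 × Fin 2 → (ℤ × ℤ) × Fin 2 → Site 2 × Fin 2 :=
    fun vd ι => (vd.1 + ![ι.1.1, ι.1.2], vd.2 + ι.2) with htgt
  -- the edges of `Wb`
  have hWb' : ∀ e ∈ Wb, e ∈ window m F η ∧ ∀ x ∈ e, ∀ (i : Fin m) (j : Fin 4),
      ∀ p ∈ (F i).side j, r ≤ dist ((η : ℂ) * squareLatticeEmbedding.z x) p := fun e he => by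
    have : e ∈ (↑Wb : Set (Sym2 (Site 2))) := he
    rw [hWb] at this
    exact this
  have hWsub : window m F η ⊆ (zdGraph 2).edgeSet := Set.iUnion_subset fun i => Set.inter_subset_right
  have hrange : ∀ e ∈ Wb, e ∈ Set.range (edgeOf : Site 2 × Fin 2 → Sym2 (Site 2)) := by
    intro e he
    have hE := hWsub (hWb' e he).1
    revert hE
    refine Sym2.ind (fun x y hE => ?_) e
    obtain ⟨d, h | h⟩ := exists_eq_edgeOf_of_adj ((SimpleGraph.mem_edgeSet _).1 hE)
    exacts [⟨_, h.symm⟩, ⟨_, h.symm⟩]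
  have hinj : Set.InjOn (edgeOf : Site 2 × Fin 2 → Sym2 (Site 2)) (edgeOf ⁻¹' ↑Wb) :=
    edgeOf_injective.injOn
  set Vb : Finset (Site 2 × Fin 2) := Wb.preimage edgeOf hinj with hVb
  have hsumWb : ∑ e ∈ Wb, P e = ∑ vd ∈ Vb, P (edgeOf vd) :=
    (Finset.sum_preimage edgeOf Wb hinj P (fun e he hne => (hne (hrange e he)).elim)).symm
  -- per-edge transfer
  have hper : ∀ vd ∈ Vb, P (edgeOf vd) ≤
      8 ^ 162 * ∑ ι ∈ I₀.filter (fun ι => ¬ ax k (tgt vd ι)), P (edgeOf (tgt vd ι)) := fun vd hvd =>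
    real_isPivotal_le_sum_targets hk F hη0 hηr I₀ hI₀ hI₀card.le vd
      (hWb' (edgeOf vd) (Finset.mem_preimage.1 hvd)).2
  -- the non-axial targets
  set W' : Finset (Sym2 (Site 2)) := I₀.biUnion fun ι =>
    (Vb.filter (fun vd => ¬ ax k (tgt vd ι))).image (fun vd => edgeOf (tgt vd ι)) with hW'
  have hinjι : ∀ ι, Function.Injective (fun vd : Site 2 × Fin 2 => edgeOf (tgt vd ι)) := by
    intro ι a b h
    have h' := edgeOf_injective h
    simp only [htgt, Prod.mk.injEq, add_left_inj] at h'
    exact Prod.ext h'.1 h'.2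
  refine ⟨W', fun e he => ?_, ?_⟩
  · obtain ⟨ι, -, he⟩ := Finset.mem_biUnion.1 he
    obtain ⟨vd, hvd, rfl⟩ := Finset.mem_image.1 he
    exact ⟨_, _, rfl, (Finset.mem_filter.1 hvd).2⟩
  -- exchange the sums
  have hinner : ∀ ι ∈ I₀, ∑ vd ∈ Vb.filter (fun vd => ¬ ax k (tgt vd ι)), P (edgeOf (tgt vd ι)) ≤
      ∑ e ∈ W', P e := by
    intro ι hι
    rw [← Finset.sum_image (f := P) (g := fun vd => edgeOf (tgt vd ι)) fun a _ b _ h => hinjι ι h]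
    exact Finset.sum_le_sum_of_subset_of_nonneg
      (Finset.subset_biUnion_of_mem (fun ι => (Vb.filter (fun vd => ¬ ax k (tgt vd ι))).image
        (fun vd => edgeOf (tgt vd ι))) hι) (fun e _ _ => hP0 e)
  have hexch : ∑ vd ∈ Vb, ∑ ι ∈ I₀.filter (fun ι => ¬ ax k (tgt vd ι)), P (edgeOf (tgt vd ι)) =
      ∑ ι ∈ I₀, ∑ vd ∈ Vb.filter (fun vd => ¬ ax k (tgt vd ι)), P (edgeOf (tgt vd ι)) := by
    simp only [Finset.sum_filter]
    exact Finset.sum_comm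
  have hbound : ∑ e ∈ Wb, P e ≤ 8 ^ 162 * 162 * ∑ e ∈ W', P e :=
    calc ∑ e ∈ Wb, P e = ∑ vd ∈ Vb, P (edgeOf vd) := hsumWb
      _ ≤ ∑ vd ∈ Vb, 8 ^ 162 * ∑ ι ∈ I₀.filter (fun ι => ¬ ax k (tgt vd ι)), P (edgeOf (tgt vd ι)) :=
          Finset.sum_le_sum hper
      _ = 8 ^ 162 * ∑ ι ∈ I₀, ∑ vd ∈ Vb.filter (fun vd => ¬ ax k (tgt vd ι)), P (edgeOf (tgt vd ι)) := by
          rw [← Finset.mul_sum, hexch]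
      _ ≤ 8 ^ 162 * ∑ _ι ∈ I₀, ∑ e ∈ W', P e :=
          mul_le_mul_of_nonneg_left (Finset.sum_le_sum hinner) (by positivity)
      _ = 8 ^ 162 * 162 * ∑ e ∈ W', P e := by
          rw [Finset.sum_const, hI₀card, nsmul_eq_mul]; push_cast; ring
  have hW'0 : 0 ≤ ∑ e ∈ W', P e := Finset.sum_nonneg fun e _ => hP0 e
  calc 1 / (8 ^ 162 * 162) * ∑ e ∈ Wb, P e
      ≤ 1 / (8 ^ 162 * 162) * (8 ^ 162 * 162 * ∑ e ∈ W', P e) :=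
        mul_le_mul_of_nonneg_left hbound (by positivity)
    _ = ∑ e ∈ W', P e := by field_simp

end Summit.CriticalPhenomena.CardyFormulaZ2.Theorems.CardySelfRefinement

end
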